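import Mathlib.Data.ZMod.QuotientGroup
import Mathlib.GroupTheory.Index
import Mathlib.Tactic.Positivity
import Mathlib.Tactic.Ring
import HarnessLib

/-!
# Route `ByReductionTypeAtTwo` (rung K4), crux `SupersingularRankZeroAtTwo` (item stmt-BirchSwinnertonDyer-19097), line
# `odd_blind_package`, slot 5 CDC_H, binder (B3glob) of the position glue (★★ p816472): **THE ABSTRACT POSITION CORE** —
# the finite-group-theory heart of the «position count for a complementary line» (cell `bsd-2adic`, LEAD ss-1 GEN 21;
# memo `HOME/ss/gen21/HAND-TARGETS-CDC-4.md` §Why)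

HONEST FRAMING: pure group theory, THEOREMS ONLY (no definition, no named fact, no `sorry`); a helper for the prover of (hglob)
`position_of_complement_of_lineCount`'s second binder. Nothing is booked; 19097 stays OPEN; BSD is proved for no curve.

THE SITUATION IT ABSTRACTS. `R = H¹_𝓡(ℚ, E[p^J])` (Kummer, relaxed at `v ∣ p`), a `p^J`-torsion group of order `p^J · #S⁰`
(Poitou–Tate: `[H¹_𝓡 : H¹_𝓢] = p^J`, `#H¹_𝓢 = #S⁰ = p^s`); `δ = κ_J(P₁) ∈ R` the Kummer class of a generator modulo torsion, of order
`p^J`; `C = Kum_J(E)_v ≅ E(ℚ_v)/p^J ≅ ℤ/p^J` generated by `u = κ_v(Q₁)` (`λ(Q₁) = 1`); `Ψ = π_K ∘ res_v : R → C` the localisation followed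
by the projection along the complementary line `L`; `Ψ δ = κ_v(P₁) = p^e u`, `e = v_p λ(P₁)`. Then `H¹_𝓛 = ker Ψ` and the theorem below
gives `#H¹_𝓛 = p^s · p^e = #S⁰ · p^{v_p λ(P₁)}` once `J ≥ e + s` — binder (hglob).

* `natCard_ker_eq_of_cyclic_position`: `R` abelian with `p^J R = 0` and `#R = p^J · p^s`, `δ ∈ R` of order `p^J`, `C` abelian generated by
  `u` of order `p^J`, `Ψ : R →+ C` with `Ψ δ = p^e • u`, `e + s ≤ J` ⟹ `#ker Ψ = p^s · p^e`.
  Proof: `p^s x ∈ ℤδ` for every `x` (index), and `p^J x = 0` forces `p^s x = p^s b δ`, so `x = bδ + f` with `p^s f = 0`; then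
  `Ψ f ∈ C[p^s] = p^{J−s} C ⊆ p^e C`, whence `range Ψ = ℤ · p^e u`, of order `p^{J−e}`; first isomorphism theorem.
bears_on: K4 (19097). References: [GreenbergLNM1716] §4 pp. 122–124 (the position of the line); [MilneADT2006] I Thm. 4.10.
-/

set_option autoImplicit false
set_option linter.dupNamespace false

namespace Summit.BirchSwinnertonDyer.BirchSwinnertonDyer.Theorems

namespace OddBlindLocal

/-- In an abelian group, a multiple `y` of an element `u` of order `p^J` with `p^s • y = 0`, `s ≤ J`, is a multiple of
`p^(J - s) • u`. [folklore] -/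
theorem mem_zmultiples_nsmul_of_nsmul_eq_zero {C : Type*} [AddCommGroup C] {p J s : ℕ} (hp : p.Prime) (hsJ : s ≤ J)
    (u : C) (hu : addOrderOf u = p ^ J) {y : C} (hy : y ∈ AddSubgroup.zmultiples u) (hys : p ^ s • y = 0) :
    y ∈ AddSubgroup.zmultiples (p ^ (J - s) • u) := by
  obtain ⟨c, rfl⟩ := AddSubgroup.mem_zmultiples_iff.mp hy
  -- `c • (p^s • u) = 0` and `addOrderOf (p^s • u) = p^(J-s)` ⟹ `p^(J-s) ∣ c`
  have hou : addOrderOf (p ^ s • u) = p ^ (J - s) := by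
    rw [addOrderOf_nsmul' u (pow_pos hp.pos s).ne', hu, Nat.gcd_eq_right (pow_dvd_pow p hsJ), Nat.pow_div hsJ hp.pos]
  have h0 : c • (p ^ s • u) = 0 := by rw [smul_comm]; exact hys
  have h2 : ((p ^ (J - s) : ℕ) : ℤ) ∣ c := by
    rw [← hou]
    exact addOrderOf_dvd_iff_zsmul_eq_zero.mpr h0
  obtain ⟨d, rfl⟩ := h2
  refine AddSubgroup.mem_zmultiples_iff.mpr ⟨d, ?_⟩
  rw [mul_comm, mul_zsmul, natCast_zsmul]

/-- **The abstract position core.** `R` abelian with `p^J R = 0` and `#R = p^J · p^s`; `δ ∈ R` of order `p^J`; `C` abelian, generated by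
`u` of order `p^J`; `Ψ : R →+ C` with `Ψ δ = p^e • u`; `e + s ≤ J`. Then `#ker Ψ = p^s · p^e`. (For the position count: `R = H¹_𝓡`,
`δ = κ_J(P₁)`, `C = Kum_J(E)_v`, `u = κ_v(Q₁)`, `Ψ = π_K ∘ res_v`, `ker Ψ = H¹_𝓛`.) [cite: GreenbergLNM1716, §4 pp. 122–124] -/
theorem natCard_ker_eq_of_cyclic_position {R C : Type*} [AddCommGroup R] [AddCommGroup C] {p J s e : ℕ} (hp : p.Prime)
    (hJ : e + s ≤ J) (hR : ∀ x : R, p ^ J • x = 0) (hRcard : Nat.card R = p ^ J * p ^ s)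
    (δ : R) (hδ : addOrderOf δ = p ^ J) (u : C) (hu : addOrderOf u = p ^ J) (hC : ∀ c : C, c ∈ AddSubgroup.zmultiples u)
    (Ψ : R →+ C) (hΨδ : Ψ δ = p ^ e • u) :
    Nat.card Ψ.ker = p ^ s * p ^ e := by
  have hp0 : 0 < p := hp.pos
  have hsJ : s ≤ J := le_trans (Nat.le_add_left s e) hJ
  have heJ : e ≤ J := le_trans (Nat.le_add_right e s) hJ
  haveI : Finite R := Nat.finite_of_card_ne_zero (by rw [hRcard]; positivity)
  set D := AddSubgroup.zmultiples δ with hD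
  -- `#D = p^J`, `[R : D] = p^s`
  have hDcard : Nat.card D = p ^ J := by rw [hD, Nat.card_zmultiples, hδ]
  have hDidx : D.index = p ^ s := by
    have h := D.index_mul_card
    rw [hDcard, hRcard] at h
    exact Nat.eq_of_mul_eq_mul_right (pow_pos hp0 J) (h.trans (mul_comm _ _))
  -- every `x` is `b • δ + f` with `p^s • f = 0`
  have hdec : ∀ x : R, ∃ (b : ℤ) (f : R), p ^ s • f = 0 ∧ x = b • δ + f := by
    intro x
    have hx : p ^ s • x ∈ D := by rw [← hDidx]; exact D.nsmul_index_mem x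
    obtain ⟨a, ha⟩ := AddSubgroup.mem_zmultiples_iff.mp hx
    -- `a • (p^(J-s) • δ) = p^J • x = 0` and `addOrderOf (p^(J-s) • δ) = p^s` ⟹ `p^s ∣ a`
    have hoδ : addOrderOf (p ^ (J - s) • δ) = p ^ s := by
      rw [addOrderOf_nsmul' δ (pow_pos hp0 (J - s)).ne', hδ, Nat.gcd_eq_right (pow_dvd_pow p (Nat.sub_le J s)),
        Nat.pow_div (Nat.sub_le J s) hp0, Nat.sub_sub_self hsJ]
    have h0 : a • (p ^ (J - s) • δ) = 0 := by
      rw [smul_comm, ha, ← mul_nsmul, ← pow_add, Nat.add_sub_cancel' hsJ, hR]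
    have h2 : ((p ^ s : ℕ) : ℤ) ∣ a := by
      rw [← hoδ]
      exact addOrderOf_dvd_iff_zsmul_eq_zero.mpr h0
    obtain ⟨b, hb⟩ := h2
    refine ⟨b, x - b • δ, ?_, (add_sub_cancel (b • δ) x).symm⟩
    rw [nsmul_sub, ← ha, hb, mul_zsmul, natCast_zsmul, sub_self]
  -- `range Ψ = ℤ · (p^e • u)`
  have hrange : Ψ.range = AddSubgroup.zmultiples (p ^ e • u) := by
    refine le_antisymm ?_ ?_
    · rintro y ⟨x, rfl⟩
      obtain ⟨b, f, hf, rfl⟩ := hdec x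
      rw [map_add, map_zsmul, hΨδ]
      refine add_mem (AddSubgroup.zsmul_mem _ (AddSubgroup.mem_zmultiples _) b) ?_
      -- `Ψ f ∈ C[p^s] ⊆ ℤ · p^(J-s) u ⊆ ℤ · p^e u`
      have hΨf : p ^ s • Ψ f = 0 := by rw [← map_nsmul, hf, map_zero]
      have h3 := mem_zmultiples_nsmul_of_nsmul_eq_zero hp hsJ u hu (hC (Ψ f)) hΨf
      obtain ⟨c, hc⟩ := AddSubgroup.mem_zmultiples_iff.mp h3
      rw [← hc]
      have hes : e ≤ J - s := by omega
      refine AddSubgroup.mem_zmultiples_iff.mpr ⟨c * (p ^ (J - s - e) : ℕ), ?_⟩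
      rw [mul_zsmul, natCast_zsmul, ← mul_nsmul, ← pow_add, Nat.add_sub_cancel' hes]
    · rw [AddSubgroup.zmultiples_le, ← hΨδ]
      exact ⟨δ, rfl⟩
  -- `#range Ψ = p^(J-e)`
  have hrcard : Nat.card Ψ.range = p ^ (J - e) := by
    rw [hrange, Nat.card_zmultiples, addOrderOf_nsmul' u (pow_pos hp0 e).ne', hu,
      Nat.gcd_eq_right (pow_dvd_pow p heJ), Nat.pow_div heJ hp0]
  -- first isomorphism theorem
  have hiso : Nat.card R = Nat.card Ψ.ker * Nat.card Ψ.range := by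
    rw [← Nat.card_congr (QuotientAddGroup.quotientKerEquivRange Ψ).toEquiv, mul_comm]
    exact AddSubgroup.card_eq_card_quotient_mul_card_addSubgroup _
  rw [hRcard, hrcard] at hiso
  have hJ' : p ^ J * p ^ s = (p ^ s * p ^ e) * p ^ (J - e) := by
    rw [show p ^ s * p ^ e * p ^ (J - e) = p ^ s * p ^ (e + (J - e)) by ring, Nat.add_sub_cancel' heJ, mul_comm]
  rw [hJ'] at hiso
  exact (Nat.eq_of_mul_eq_mul_right (pow_pos hp0 (J - e)) hiso).symm

end OddBlindLocal

end Summit.BirchSwinnertonDyer.BirchSwinnertonDyer.Theorems
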